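import Mathlib
import Summits.ValiantsHypothesis.ValiantsHypothesis.Theses.PermanentalCones
import Summits.ValiantsHypothesis.ValiantsHypothesis.Theorems.PermanentalConesPermanentalHyperbolic
import Summits.ValiantsHypothesis.ValiantsHypothesis.Theorems.PermanentalConesPermanentalConeHardGardingGradient
import Summits.ValiantsHypothesis.ValiantsHypothesis.Theorems.PermanentalConesPermanentalConeHardShadowSlackFactor
import Summits.ValiantsHypothesis.ValiantsHypothesis.Theorems.PermanentalConesPermanentalConeHardSlackAsPermanent
import Summits.ValiantsHypothesis.ValiantsHypothesis.Theorems.PermanentalConesPermanentalConeHardGradientCut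
import Literature.AlgebraicGeometry.HyperbolicPolynomials.HyperbolicityCone
import Literature.AlgebraicGeometry.HyperbolicPolynomials.Garding
import Literature.AlgebraicGeometry.HyperbolicPolynomials.SmoothBoundary
import Literature.AlgebraicGeometry.HyperbolicPolynomials.SpectrahedralShadow

/-!
# `PermanentalConeHard` (stmt-ValiantsHypothesis-8654), line `birth` — the core stub IS the crux

Route `PermanentalCones` of `ValiantsHypothesis`, crux `PermanentalConeHard` (H+).  The registered
skeleton `Cruxes/PermanentalConeHard/Lines/birth.lean` reduces H+ to ONE open stub,
`stub_permanentalGradientPsdRank` (CORE): permanental witnesses whose GRADIENT SLACK MATRICES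
`S[x,z] = gradForm Q_n z x = ⟨∇Q_n(z), x⟩` (`x, z ∈ Λ₊(Q_n, 𝟙)`) admit no positive-semidefinite
factorisation `S[x,z] = tr(U_x V_z)`, `U_x, V_z ∈ 𝕊^m_+`, for any `m ≤ 2^((log₂ n + c)^c)`.  The
skeleton proves CORE → H+ (Gouveia–Parrilo–Thomas: a lifted-LMI description factorises every slack
matrix).  This file proves the CONVERSE, so that the stub is recorded as *literally equivalent* to
the crux (`permanentalConeHard_iff_core`): no re-lining inside the GPT reduction can make the
remaining obligation smaller than H+ itself, and conversely every lower-bound technique for H+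
may assume the universal slack configuration (all of `Λ₊ × Λ₊`, gradient functionals only).

* `trace_mul_nonneg_of_posSemidef` — bookkeeping.
* `isSpectrahedralShadowOfSize_of_psdFactor` — **GPT, converse direction, for cones cut out by a
  self-indexed family of functionals**: a size-`m` psd factorisation `L z x = tr(U_x V_z)` on
  `K × K` of a family `L z` (linear in `x`) with `K = {x : L z x ≥ 0 ∀ z ∈ K}` and `K ∋ e_j` for
  all `j` yields a lifted-LMI description of `K` of size `m` (the lift is the linear subspace
  `{(x, M) : L z x = tr(M V_z) ∀ z}` met with `𝕊^m_+`, parametrised by the section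
  `x ↦ Σ x_j U_{e_j}` and a basis of its vertical part `{N : tr(N V_k) = 0 ∀ k}`).
* `core_of_permanentalConeHard` (H+ ⇒ CORE, using `hyperbolicityCone_eq_setOf_forall_gradForm_nonneg`
  of `…GradientCut.lean`), `permanentalConeHard_of_core` (CORE ⇒ H+, the skeleton's composition of
  the landed `stub_shadowSlackFactor` and `stub_gardingGradient`), `permanentalConeHard_iff_core`.

References: Gouveia–Parrilo–Thomas, *Lifts of convex sets and cone factorizations*,
Math. Oper. Res. 38 (2013), Thm 1 (both directions).  Everything here is proved in full.
-/

set_option linter.dupNamespace false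

noncomputable section

namespace Summit.ValiantsHypothesis.ValiantsHypothesis.Theorems.PermanentalConesPermanentalConeHard

open MvPolynomial Finset
open scoped BigOperators Polynomial Matrix
open Literature.AlgebraicGeometry.HyperbolicPolynomials

/-! ## §2  Gouveia–Parrilo–Thomas, converse direction: a psd factorisation gives a lift -/

section Lift

variable {n m : ℕ}

/-- `tr(U V) ≥ 0` for real positive-semidefinite `U, V` (`V = Bᵀ B`, `tr(U Bᵀ B) = tr(B U Bᵀ)`).
[folklore] -/
theorem trace_mul_nonneg_of_posSemidef {U V : Matrix (Fin m) (Fin m) ℝ} (hU : U.PosSemidef)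
    (hV : V.PosSemidef) : 0 ≤ (U * V).trace := by
  obtain ⟨B, hB⟩ : ∃ B : Matrix (Fin m) (Fin m) ℝ, V = star B * B := by
    open scoped MatrixOrder in exact CStarAlgebra.nonneg_iff_eq_star_mul_self.mp hV.nonneg
  rw [hB, Matrix.star_eq_conjTranspose, ← Matrix.mul_assoc, Matrix.trace_mul_comm]
  have h : (B * (U * Bᴴ)) = (Bᴴ)ᴴ * U * Bᴴ := by
    rw [Matrix.conjTranspose_conjTranspose, Matrix.mul_assoc]
  rw [h]
  exact (hU.conjTranspose_mul_mul_same Bᴴ).trace_nonneg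

/-- **GPT, converse direction (factorisation ⇒ lifted LMI), for a cone cut out by a self-indexed
family of linear functionals.**  Let `K ⊆ ℝⁿ` satisfy `K = {x : L z x ≥ 0 ∀ z ∈ K}` for linear
functionals `L z`, contain the coordinate vectors, and let `L k x = tr(U_x V_k)` (`x, k ∈ K`) with
`U_x, V_k ∈ 𝕊^m_+`.  Then `K = {x : ∃ y, A(x, y) ⪰ 0}` for a linear `A` into `m × m` matrices:
`A(x, y) = Σⱼ xⱼ U_{eⱼ} + Σᵢ yᵢ Nᵢ` with `(Nᵢ)` a basis of `{N : tr(N V_k) = 0 ∀ k}`.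
[cite: GouveiaParriloThomas2013, Theorem 1 (factorisation ⇒ lift)] -/
theorem isSpectrahedralShadowOfSize_of_psdFactor {K : Set (Fin n → ℝ)}
    (L : (Fin n → ℝ) → (Fin n → ℝ) →ₗ[ℝ] ℝ) (hK : ∀ x, x ∈ K ↔ ∀ z ∈ K, 0 ≤ L z x)
    (hbasis : ∀ j : Fin n, (Pi.single j 1 : Fin n → ℝ) ∈ K)
    (U V : K → Matrix (Fin m) (Fin m) ℝ) (hU : ∀ i, (U i).PosSemidef)
    (hV : ∀ k, (V k).PosSemidef) (hfac : ∀ i k : K, L k.1 i.1 = (U i * V k).trace) :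
    IsSpectrahedralShadowOfSize K m := by
  classical
  -- the linear section `x ↦ Σⱼ xⱼ U_{eⱼ}` of the lift
  let Ue : Fin n → Matrix (Fin m) (Fin m) ℝ := fun j => U ⟨Pi.single j 1, hbasis j⟩
  let M₀ : (Fin n → ℝ) →ₗ[ℝ] Matrix (Fin m) (Fin m) ℝ := Fintype.linearCombination ℝ Ue
  have hM₀ : ∀ (x : Fin n → ℝ) (k : K), L k.1 x = (M₀ x * V k).trace := by
    intro x k
    have hx : x = ∑ j, x j • (Pi.single j 1 : Fin n → ℝ) := by
      conv_lhs => rw [← Finset.univ_sum_single x]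
      refine Finset.sum_congr rfl fun j _ => ?_
      rw [← Pi.single_smul', smul_eq_mul, mul_one]
    conv_lhs => rw [hx]
    simp only [map_sum, map_smul, smul_eq_mul, M₀, Fintype.linearCombination_apply,
      Finset.sum_mul, Matrix.smul_mul, Matrix.trace_sum, Matrix.trace_smul]
    exact Finset.sum_congr rfl fun j _ => by rw [hfac ⟨Pi.single j 1, hbasis j⟩ k]
  -- the vertical part `L₀ = {N : tr(N V_k) = 0 ∀ k}` and a basis of it
  let Φ : Matrix (Fin m) (Fin m) ℝ →ₗ[ℝ] (K → ℝ) :=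
    LinearMap.pi fun k : K => (Matrix.traceLinearMap (Fin m) ℝ ℝ).comp (LinearMap.mulRight ℝ (V k))
  let L₀ : Submodule ℝ (Matrix (Fin m) (Fin m) ℝ) := LinearMap.ker Φ
  have hL₀ : ∀ N : Matrix (Fin m) (Fin m) ℝ, N ∈ L₀ ↔ ∀ k : K, (N * V k).trace = 0 := by
    intro N
    rw [LinearMap.mem_ker, funext_iff]
    exact forall_congr' fun k => Iff.rfl
  let p := Module.finrank ℝ L₀
  let b : Module.Basis (Fin p) ℝ L₀ := Module.finBasis ℝ L₀
  let W : (Fin p → ℝ) →ₗ[ℝ] Matrix (Fin m) (Fin m) ℝ :=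
    Fintype.linearCombination ℝ fun i => ((b i : L₀) : Matrix (Fin m) (Fin m) ℝ)
  have hW : ∀ (y : Fin p → ℝ) (k : K), (W y * V k).trace = 0 := by
    intro y k
    simp only [W, Fintype.linearCombination_apply, Finset.sum_mul, Matrix.smul_mul,
      Matrix.trace_sum, Matrix.trace_smul]
    refine Finset.sum_eq_zero fun i _ => ?_
    rw [(hL₀ _).1 (b i).2 k, smul_zero]
  let A : (Fin n → ℝ) × (Fin p → ℝ) →ₗ[ℝ] Matrix (Fin m) (Fin m) ℝ :=
    M₀.comp (LinearMap.fst ℝ _ _) + W.comp (LinearMap.snd ℝ _ _)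
  have hA : ∀ (x : Fin n → ℝ) (y : Fin p → ℝ), A (x, y) = M₀ x + W y := fun x y => rfl
  refine ⟨p, A, 0, fun x => ⟨fun hx => ?_, fun ⟨y, hy⟩ => ?_⟩⟩
  · -- `x ∈ K`: `U_x - M₀ x` is vertical, so `U_x = A(x, y)` for its coordinates `y`
    have hD : U ⟨x, hx⟩ - M₀ x ∈ L₀ := by
      rw [hL₀]
      intro k
      rw [Matrix.sub_mul, Matrix.trace_sub, ← hfac ⟨x, hx⟩ k, ← hM₀ x k, sub_self]
    refine ⟨b.equivFun ⟨_, hD⟩, ?_⟩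
    have hWy : W (b.equivFun ⟨_, hD⟩) = U ⟨x, hx⟩ - M₀ x := by
      have hsum := b.sum_equivFun ⟨_, hD⟩
      have hcoe := congrArg (fun u : L₀ => (u : Matrix (Fin m) (Fin m) ℝ)) hsum
      simp only [Submodule.coe_sum, Submodule.coe_smul] at hcoe
      simpa only [W, Fintype.linearCombination_apply] using hcoe
    rw [add_zero, hA, hWy, add_sub_cancel]
    exact hU ⟨x, hx⟩
  · -- `A(x, y) ⪰ 0`: pair with every `V_k`
    rw [add_zero, hA] at hy
    refine (hK x).2 fun z hz => ?_
    have htr : L z x = ((M₀ x + W y) * V ⟨z, hz⟩).trace := by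
      rw [Matrix.add_mul, Matrix.trace_add, hW y ⟨z, hz⟩, add_zero]
      exact hM₀ x ⟨z, hz⟩
    rw [htr]
    exact trace_mul_nonneg_of_posSemidef hy (hV ⟨z, hz⟩)

end Lift

/-! ## §3  H+ ⇒ CORE, and the equivalence -/

section Crux

open Summit.ValiantsHypothesis.ValiantsHypothesis.Theses.PermanentalCones

/-- **H+ ⇒ CORE.**  If the permanental witnesses `Q_n` have no lifted-LMI description of size
`m`, then the gradient slack matrix on ALL of `Λ₊(Q_n, 𝟙) × Λ₊(Q_n, 𝟙)` has no psd factorisation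
of size `m` (else `isSpectrahedralShadowOfSize_of_psdFactor` builds the forbidden lift, the cone
being cut out by its gradients, `hyperbolicityCone_eq_setOf_forall_gradForm_nonneg`).
[cite: GouveiaParriloThomas2013, Theorem 1] -/
theorem core_of_permanentalConeHard : PermanentalConeHard →
    ∃ (r : ℕ → ℕ) (Y : ∀ n : ℕ, Matrix (Fin n) (Fin n) ℝ), (∀ n i j, 0 ≤ Y n i j) ∧
      ∀ P : ∀ n : ℕ, MvPolynomial (Fin n) ℝ,
        (∀ n, P n = (Matrix.of fun i j : Fin n =>
          if (i : ℕ) < r n then MvPolynomial.C (Y n i j) else MvPolynomial.X j).permanent) →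
        (∀ n : ℕ, 0 < MvPolynomial.eval (fun _ => (1 : ℝ)) (P n)) ∧
        ∀ c : ℕ, ∃ n : ℕ, ∀ m ≤ 2 ^ ((Nat.log 2 n + c) ^ c),
          ∃ (ι κ : Type) (xs : ι → Fin n → ℝ) (zs : κ → Fin n → ℝ),
            (∀ i, xs i ∈ hyperbolicityCone (P n) (fun _ => (1 : ℝ))) ∧
            (∀ k, zs k ∈ hyperbolicityCone (P n) (fun _ => (1 : ℝ))) ∧
            ¬ ∃ (U : ι → Matrix (Fin m) (Fin m) ℝ) (V : κ → Matrix (Fin m) (Fin m) ℝ),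
                (∀ i, (U i).PosSemidef) ∧ (∀ k, (V k).PosSemidef) ∧
                ∀ i k, gradForm (P n) (zs k) (xs i) = Matrix.trace (U i * V k) := by
  classical
  rintro ⟨r, Y, hY, h⟩
  refine ⟨r, Y, hY, fun P hP => ?_⟩
  obtain ⟨hhyp, hhard⟩ := h P hP
  -- positivity of `Q_n(𝟙)`: nonzero (H+) and a permanent of a nonnegative matrix
  have hpos : ∀ n, 0 < MvPolynomial.eval (fun _ => (1 : ℝ)) (P n) := by
    intro n
    refine lt_of_le_of_ne ?_ (hhyp n).1.symm
    rw [hP n, eval_rowPermanent]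
    refine permanent_nonneg fun a b => ?_
    simp only [Matrix.of_apply]
    split_ifs
    · exact hY n a b
    · exact zero_le_one
  refine ⟨hpos, fun c => ?_⟩
  obtain ⟨n, hn⟩ := hhard c
  refine ⟨n, fun m hm => ?_⟩
  -- the cone, its homogeneity / hyperbolicity data
  set K := hyperbolicityCone (P n) (fun _ => (1 : ℝ)) with hKdef
  have hhom : (P n).IsHomogeneous (∑ j : Fin n, (if (j : ℕ) < r n then 0 else 1)) := by
    rw [hP n]; exact isHomogeneous_rowPermanent (Y n) (r n)
  have hIs : IsHyperbolic (P n) (fun _ => (1 : ℝ)) :=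
    ⟨(hhyp n).1, fun x z hz => (hhyp n).2 x z (by simpa using hz)⟩
  have hcut : ∀ x, x ∈ K ↔ ∀ z ∈ K, 0 ≤ gradForm (P n) z x := fun x =>
    Set.ext_iff.1 (hyperbolicityCone_eq_setOf_forall_gradForm_nonneg hhom hIs (hpos n)) x
  have hbasis : ∀ j : Fin n, (Pi.single j 1 : Fin n → ℝ) ∈ K := by
    intro j
    rw [hKdef, hP n]
    refine mem_hyperbolicityCone_rowPermanent_of_nonneg (Y n) (r n) (hY n) ?_ fun i => ?_
    · rw [← hP n]; exact (hhyp n).1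
    · by_cases h : i = j
      · subst h; simp
      · simp [h]
  have hline : ∀ (x : Fin n → ℝ) (τ : ℝ), x + τ • (fun _ : Fin n => (1 : ℝ)) = fun j => x j + τ := by
    intro x τ; funext j; simp
  have hmem : ∀ x : Fin n → ℝ, x ∈ K ↔
      ∀ τ : ℝ, 0 < τ → MvPolynomial.eval (fun j => x j + τ) (P n) ≠ 0 := fun x =>
    (mem_hyperbolicityCone_iff _ _ _).trans (forall_congr' fun τ => by rw [hline x τ])
  -- the universal slack configuration: all of `K × K`
  refine ⟨K, K, Subtype.val, Subtype.val, fun i => i.2, fun k => k.2, ?_⟩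
  rintro ⟨U, V, hU, hV, hfac⟩
  obtain ⟨p, A, B, hrep⟩ := isSpectrahedralShadowOfSize_of_psdFactor
    (fun z => gradForm (P n) z) hcut hbasis U V hU hV (fun i k => hfac i k)
  exact hn m hm p A B fun x => (hmem x).symm.trans (hrep x)

/-- **CORE ⇒ H+** (the composition of the registered skeleton `Lines/birth.lean`, with the landed
`stub_shadowSlackFactor` and `stub_gardingGradient`): a purported lifted-LMI description of size
`m` factorises the gradient slack matrix the core statement says is unfactorisable.
[cite: GouveiaParriloThomas2013, Theorem 1 (lift ⇒ factorisation)] -/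
theorem permanentalConeHard_of_core :
    (∃ (r : ℕ → ℕ) (Y : ∀ n : ℕ, Matrix (Fin n) (Fin n) ℝ), (∀ n i j, 0 ≤ Y n i j) ∧
      ∀ P : ∀ n : ℕ, MvPolynomial (Fin n) ℝ,
        (∀ n, P n = (Matrix.of fun i j : Fin n =>
          if (i : ℕ) < r n then MvPolynomial.C (Y n i j) else MvPolynomial.X j).permanent) →
        (∀ n : ℕ, 0 < MvPolynomial.eval (fun _ => (1 : ℝ)) (P n)) ∧
        ∀ c : ℕ, ∃ n : ℕ, ∀ m ≤ 2 ^ ((Nat.log 2 n + c) ^ c),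
          ∃ (ι κ : Type) (xs : ι → Fin n → ℝ) (zs : κ → Fin n → ℝ),
            (∀ i, xs i ∈ hyperbolicityCone (P n) (fun _ => (1 : ℝ))) ∧
            (∀ k, zs k ∈ hyperbolicityCone (P n) (fun _ => (1 : ℝ))) ∧
            ¬ ∃ (U : ι → Matrix (Fin m) (Fin m) ℝ) (V : κ → Matrix (Fin m) (Fin m) ℝ),
                (∀ i, (U i).PosSemidef) ∧ (∀ k, (V k).PosSemidef) ∧
                ∀ i k, gradForm (P n) (zs k) (xs i) = Matrix.trace (U i * V k)) →
    PermanentalConeHard := by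
  rintro ⟨r, Y, hY, h⟩
  refine ⟨r, Y, hY, fun P hP => ?_⟩
  obtain ⟨hpos, hhard⟩ := h P hP
  have h1ne : ∀ n, MvPolynomial.eval (fun _ => (1 : ℝ)) (P n) ≠ 0 := fun n => (hpos n).ne'
  have hhyp : ∀ (n : ℕ) (x : Fin n → ℝ) (z : ℂ), MvPolynomial.eval (fun j => (x j : ℂ) + z)
      (MvPolynomial.map (algebraMap ℝ ℂ) (P n)) = 0 → z.im = 0 :=
    fun n => Summit.ValiantsHypothesis.ValiantsHypothesis.Theorems.permanentalHyperbolic_proof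
      n (r n) (Y n) (hY n) (P n) (hP n) (h1ne n)
  refine ⟨fun n => ⟨h1ne n, hhyp n⟩, fun c => ?_⟩
  obtain ⟨n, hn⟩ := hhard c
  refine ⟨n, fun m hm p A B hrep => ?_⟩
  obtain ⟨ι, κ, xs, zs, hxs, hzs, hno⟩ := hn m hm
  have hhom : (P n).IsHomogeneous (∑ j : Fin n, (if (j : ℕ) < r n then 0 else 1)) := by
    rw [hP n]; exact isHomogeneous_rowPermanent (Y n) (r n)
  have hline : ∀ (x : Fin n → ℝ) (τ : ℝ), x + τ • (fun _ : Fin n => (1 : ℝ)) = fun j => x j + τ := by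
    intro x τ; funext j; simp
  have hmem : ∀ x : Fin n → ℝ, x ∈ hyperbolicityCone (P n) (fun _ => (1 : ℝ)) ↔
      ∀ τ : ℝ, 0 < τ → MvPolynomial.eval (fun j => x j + τ) (P n) ≠ 0 := fun x =>
    (mem_hyperbolicityCone_iff _ _ _).trans (forall_congr' fun τ => by rw [hline x τ])
  have hIs : IsHyperbolic (P n) (fun _ => (1 : ℝ)) :=
    ⟨h1ne n, fun x z hz => hhyp n x z (by simpa using hz)⟩
  have hshadow : IsSpectrahedralShadowOfSize (hyperbolicityCone (P n) (fun _ => (1 : ℝ))) m :=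
    ⟨p, A, B, fun x => (hmem x).trans (hrep x)⟩
  have h0 : (0 : Fin n → ℝ) ∈ hyperbolicityCone (P n) (fun _ => (1 : ℝ)) :=
    zero_mem_hyperbolicityCone hhom (h1ne n)
  exact hno (stub_shadowSlackFactor n m _ hshadow h0 ι κ xs (fun k => gradForm (P n) (zs k)) hxs
    (fun k x hx => stub_gardingGradient n _ (P n) (fun _ => 1) hhom hIs (hpos n) (zs k) (hzs k) x hx))

/-- **The core stub of line `birth` is equivalent to the crux**: H+ (`PermanentalConeHard`, no
quasi-polynomial lifted-LMI description of the permanental cones) holds iff the gradient slack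
matrices of the permanental cones have super-quasi-polynomial psd-rank
(`stub_permanentalGradientPsdRank` of `Cruxes/PermanentalConeHard/Lines/birth.lean`, verbatim).
[cite: GouveiaParriloThomas2013, Theorem 1] -/
theorem permanentalConeHard_iff_core : PermanentalConeHard ↔
    ∃ (r : ℕ → ℕ) (Y : ∀ n : ℕ, Matrix (Fin n) (Fin n) ℝ), (∀ n i j, 0 ≤ Y n i j) ∧
      ∀ P : ∀ n : ℕ, MvPolynomial (Fin n) ℝ,
        (∀ n, P n = (Matrix.of fun i j : Fin n =>
          if (i : ℕ) < r n then MvPolynomial.C (Y n i j) else MvPolynomial.X j).permanent) →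
        (∀ n : ℕ, 0 < MvPolynomial.eval (fun _ => (1 : ℝ)) (P n)) ∧
        ∀ c : ℕ, ∃ n : ℕ, ∀ m ≤ 2 ^ ((Nat.log 2 n + c) ^ c),
          ∃ (ι κ : Type) (xs : ι → Fin n → ℝ) (zs : κ → Fin n → ℝ),
            (∀ i, xs i ∈ hyperbolicityCone (P n) (fun _ => (1 : ℝ))) ∧
            (∀ k, zs k ∈ hyperbolicityCone (P n) (fun _ => (1 : ℝ))) ∧
            ¬ ∃ (U : ι → Matrix (Fin m) (Fin m) ℝ) (V : κ → Matrix (Fin m) (Fin m) ℝ),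
                (∀ i, (U i).PosSemidef) ∧ (∀ k, (V k).PosSemidef) ∧
                ∀ i k, gradForm (P n) (zs k) (xs i) = Matrix.trace (U i * V k) :=
  ⟨core_of_permanentalConeHard, permanentalConeHard_of_core⟩

/-- Registered form (`stub_coreIffCrux`, infrastructure stub of the core
`stub_permanentalGradientPsdRank`): the crux is equivalent to the core stub, verbatim.
[cite: GouveiaParriloThomas2013, Theorem 1] -/
theorem stub_coreIffCrux : Summit.ValiantsHypothesis.ValiantsHypothesis.Theses.PermanentalCones.PermanentalConeHard ↔ ∃ (r : ℕ → ℕ) (Y : ∀ n : ℕ, Matrix (Fin n) (Fin n) ℝ), (∀ n i j, 0 ≤ Y n i j) ∧ ∀ P : ∀ n : ℕ, MvPolynomial (Fin n) ℝ, (∀ n, P n = (Matrix.of fun i j : Fin n => if (i : ℕ) < r n then MvPolynomial.C (Y n i j) else MvPolynomial.X j).permanent) → (∀ n : ℕ, 0 < MvPolynomial.eval (fun _ => (1 : ℝ)) (P n)) ∧ ∀ c : ℕ, ∃ n : ℕ, ∀ m ≤ 2 ^ ((Nat.log 2 n + c) ^ c), ∃ (ι κ : Type) (xs : ι → Fin n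 → ℝ) (zs : κ → Fin n → ℝ), (∀ i, xs i ∈ hyperbolicityCone (P n) (fun _ => (1 : ℝ))) ∧ (∀ k, zs k ∈ hyperbolicityCone (P n) (fun _ => (1 : ℝ))) ∧ ¬ ∃ (U : ι → Matrix (Fin m) (Fin m) ℝ) (V : κ → Matrix (Fin m) (Fin m) ℝ), (∀ i, (U i).PosSemidef) ∧ (∀ k, (V k).PosSemidef) ∧ ∀ i k, gradForm (P n) (zs k) (xs i) = Matrix.trace (U i * V k) :=
  permanentalConeHard_iff_core

end Crux

end Summit.ValiantsHypothesis.ValiantsHypothesis.Theorems.PermanentalConesPermanentalConeHard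

end
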